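/-
Copyright (c) 2026. All rights reserved.
Released under Apache 2.0 license as described in the file LICENSE.
-/
import Literature.NumberTheory.ComplexMultiplication.DegenerateCMTypesCyclicTwoOddPrimes
import Literature.AlgebraicGeometry.ComplexMultiplication.CyclotomicFermatCMTypesPrimeLevel
import Literature.AlgebraicGeometry.ComplexMultiplication.CyclotomicCMTypeResidueSets
import Literature.AlgebraicGeometry.Pohlmann1968.DegenerateCMTypesRibetLenstraSerre
import HarnessLib

/-!
# Hazama's classification of the degenerate CM types of a cyclic CM field of degree `2pq`, dressed on the
# cyclotomic fields `ℚ(ζ_ℓ)`, `ℓ = 2pq + 1` prime: degeneracy read on residues, exceptional Hodge classes of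
# codimension `p` on the `p`-dominated abelian varieties, the Hodge conjecture for the powers of the others

Layer `Literature/AlgebraicGeometry/ComplexMultiplication`; the number-field / abelian-variety dress of the group-level
file `NumberTheory/ComplexMultiplication/DegenerateCMTypesCyclicTwoOddPrimes` (Hazama 2003, Thm. 4.8 on a "frame"
`CyclicFrame p q ρ τ κ` of a finite commutative group of order `2pq`).  THEOREMS ONLY (no definition, no named fact,
no `sorry`).

## The print

F. Hazama, *Hodge cycles on abelian varieties with complex multiplication by cyclic CM-fields*, J. Math. Sci. Univ.
Tokyo **10** (2003) 581–598 [Hazama2003CyclicCM] (held text `paper:w2141840783`, p. 594–598):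

> THEOREM 4.8. Let `p, q` be distinct odd primes. Let `CM` denote the set of CM-types for a cyclic galois CM-field
> of degree `2pq`. Let `Deg` denote the subset of `CM` consisting of degenerate CM-types, and `Prim` (resp.
> `NonPrim`) the subset of primitive (resp. nonprimitive) CM-types. Let `N Dom` denote the subset of `CM` consisting
> of `N`-dominated CM-types. Moreover for any divisor `d` of `2pq`, let
> `S_d = {S ∈ CM ; χ(S) = 0 for one (hence every) character of degree 2pq/(d, 2pq)}`. Then (i) `CM = Prim ∪ Nonprim`,
> (ii) `Deg = S₁ ∪ S_p ∪ S_q`, where `S_p ∩ S_q = {{2b}, {2b+1}} ⊂ S₁`, (iii) `Nonprim = S₁`,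
> (iv) `Prim ∩ p-Dom = S_p − S₁`, (v) `Prim ∩ q-Dom = S_q − S₁`, (vi) all the primitive and degenerate CM-types are
> `1`-degenerate.
> §5 (p. 596–597): "if a CM-type `S` is degenerate and primitive, then `S ∈ S_p − S₁` or `S ∈ S_q − S₁` … a `ℤ`-basis
> of `V_{2q} ∩ ℤ[ℤ/2nℤ]` is given by `w_k^{(2q)}`, `1 ≤ k ≤ q − 1`. Moreover the weight of the inverses
> `F⁻¹(w_k^{(2q)})` are equal to `p` for any `k`. Therefore the abelian variety `A` is `p`-dominated.
> Furthermore the height of them are equal to one".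
> REMARK 4.9. "For sufficiently large prime `2n + 1 ≡ 7 (mod 12)`, Lenstra and Stark noticed that there is always
> a degenerate CM-type for `ℚ(ζ_{2n+1})` (see [5, (3.11)]). … our theorem for `p = 3` gives a constructive version
> of this result to the effect that there is always a degenerate CM-type for `ℚ(ζ_{2n+1})` whenever `n` is the
> product of three and an odd prime `> 3`."
> REMARK 4.10. "It is shown by Lenstra that for any abelian variety `A` with complex multiplication by an abelian
> CM-field, there always exists a nondivisorial Hodge cycle on `A` itself if `A` is degenerate (see [7])."
> §6 (p. 597): "`K₃₁ = ℚ(ζ₃₁)` … `G₃₁ ≅ (ℤ/31ℤ)^*` … the abelian variety `A_S` associated to it is absolutely simple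
> and `3`-dominated by Theorem 4.8."

B. B. Gordon, *A survey of the Hodge conjecture for abelian varieties* [Gordon1999HodgeAVSurvey], 9.2 and 9.2.2
(Pohlmann's criterion in White's form: a Galois-balanced `Δ` of `2m` embeddings with some `φ ∈ Δ`, `φ̄ ∉ Δ` gives,
on a SIMPLE `A`, a Hodge `(m,m)`-class outside `Dᵐ(A)`), 9.4.1–9.4.2 (Kubota's rank on residues), Thm. 6.4 and §9.3
(nondegenerate ⟹ `Hdg(Aᵏ) = Div(Aᵏ)` for all `k`).

## Dictionary

For a prime `ℓ` with `ℓ − 1 = 2pq` the Galois group `Gal(ℚ(ζ_ℓ)/ℚ) = (ℤ/ℓ)ˣ` is cyclic of order `2pq`, complex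
conjugation is `ρ = −1`, and any units `τ`, `κ` of orders `p`, `q` complete it to a frame
(`cyclicFrame_units`, `exists_cyclicFrame_units`).  A CM type of `L = ℚ(ζ_ℓ)` is `Φ_S = {σ | e(σ) ∈ S}`
(`Pohlmann1968.Cyclotomic.cmTypeOfResidues S hS`; every CM type is of this form, `cmTypeEquivResidueSets`) for a CM
residue set `S` (`c ∈ S ↔ −c ∉ S` on units); on the group side it is the finite set
`𝓤[ℓ, S] = {u ∈ (ℤ/ℓ)ˣ : u mod ℓ ∈ S}` — LOCAL NOTATION of this file for
`Finset.univ.filter fun u : (ZMod ℓ)ˣ => (u : ZMod ℓ) ∈ S` (the carrier of the tree's `isCMTypeWith_unitsFilter`,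
`cmTypeRank_cmTypeOfResidues_eq`).  Hazama's classes: `S ∈ S_p` = `HasConstantRows p q 𝓤[ℓ,S] τ κ` (`S` meets every
coset of the subgroup of order `p` inside the squares in the same number of points; read on residues:
`hasConstantRows_iff_card_filter`), `S ∈ S_q` = `HasConstantRows q p 𝓤[ℓ,S] κ τ`, `S ∈ S₁` = `S` has a non-trivial
stabiliser (`IsStableUnder 𝓤[ℓ,S] τ ∨ IsStableUnder 𝓤[ℓ,S] κ`, `exists_isStableUnder_iff`); "primitive" is the tree's
`IsPrimitive (ℂ ≃+* ℂ) Φ.1 φ₀` = `HasTrivialStabilizer ℓ S` (`isPrimitive_iff_hasTrivialStabilizer`) = no unit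
`u ≠ 1` stabilises `𝓤[ℓ,S]` (`hasTrivialStabilizer_iff`); "degenerate" is `¬ IsNondegenerate Φ_S`
(`cmTypeRank Φ_S ≠ pq + 1`, Dodson / Kubota).

## What is proved

* §1 `cyclicFrame_units`, `cyclicFrame_units_of_pow_eq_one`, `exists_cyclicFrame_units` — the frame
  `((ℤ/ℓ)ˣ; −1, τ, κ)` for a prime `ℓ = 2pq + 1`.
* §2 (read on residues) `rowCount_eq_card_filter`, `hasConstantRows_iff_card_filter`, `isStableUnder_iff`,
  `hasTrivialStabilizer_iff`, `separating_of_hasTrivialStabilizer`.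
* §3 THEOREM 4.8 FOR `ℚ(ζ_ℓ)`: **`not_isNondegenerate_iff`** (`Φ_S` is degenerate iff `S ∈ S_p ∪ S_q ∪ S₁`:
  constant rows, or constant columns, or a stabiliser of order `p` or `q`), `isNondegenerate_iff`,
  **`isPrimitive_iff`** ((iii): primitive iff no non-trivial stabiliser), **`not_isNondegenerate_iff_of_primitive`**
  ((ii)+(iii)+Prop. 4.5: a PRIMITIVE `Φ_S` is degenerate iff EXACTLY ONE of constant rows / constant columns holds —
  the `p`-dominated, resp. `q`-dominated, primitive types `(S_p − S₁) ⊔ (S_q − S₁)`).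
* §4 ON ABELIAN VARIETIES `(A, ι, θ)` of type `(ℚ(ζ_ℓ); Φ_S)` read on `H¹` (`IsCMTypeRealisation`): `dim_eq`
  (`dim A = pq`), `isSimple_of_hasTrivialStabilizer` (primitive ⟹ simple, Shimura §8.2 Prop. 26);
  **`exists_exceptional_of_hasConstantRows`** = (iv) + §5 + 9.2.2: for a PRIMITIVE `p`-DOMINATED `S` every `A` of
  type `Φ_S` carries a rational `(p,p)`-class OUTSIDE `Dᵖ(A) ⊗ ℂ` — a "nondivisorial Hodge cycle on `A` itself"
  (Rem. 4.10) in codimension `p`, the weight-`p` height-one kernel elements of §5 being the explicit balanced sets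
  `Δ(y₁, y₂) = {τˣκ^{y₁}} ∪ {ρτˣκ^{y₂}}` of the group-level file (`isBalanced_hazamaSet`);
  `exists_exceptional_of_hasConstantCols` (the `q`-dominated case, codimension `q`);
  **`exists_exceptional_of_not_isNondegenerate`** (Rem. 4.10 for these fields, constructively: a primitive
  degenerate `Φ_S` forces an exceptional Hodge class on `A` ITSELF, in codimension `p` or `q`);
  **`hodgeConjectureFor_pow_of_not_mem`** (the other side of Thm. 4.8 (ii) with White–Hazama, tree
  `IsNondegenerate.hodgeConjectureFor_pow`: if `S ∉ S₁ ∪ S_p ∪ S_q` then EVERY power of every abelian variety of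
  type `Φ_S` satisfies the Hodge conjecture, unconditionally); `exists_realisation_exceptional_of_hasConstantRows`
  (such `A` exist: Shimura §6.2 Thm. 3 = tree `exists_isCMTypeRealisation`).

* §5 **`cmTypeRank_eq_of_hasConstantRows`** (a primitive `p`-dominated `Φ_S` has rank `(p − 1)q + 2`, i.e.
  `dim Hg(A) = pq − q + 1`: §5 of the paper, the kernel is spanned by the `q − 1` elements `w_k^{(2q)}`),
  `cmTypeRank_eq_of_hasConstantCols` (`(q − 1)p + 2`), `cmTypeRank_add_defect_eq` (Prop. 2.1 + Thm. 4.8: rank +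
  defect `= pq + 1`), `exists_primitive_hasConstantRows_residues`, **`exists_primitive_degenerate`** = REMARK 4.9 for
  every pair `p ≠ q` (for every prime `ℓ = 2pq + 1` the field `ℚ(ζ_ℓ)` HAS a primitive degenerate CM type, of rank
  `(p − 1)q + 2`, all of whose abelian varieties are simple `pq`-folds with a rational `(p,p)`-class outside
  `Dᵖ ⊗ ℂ`), **`exists_simple_degenerate_exceptional`** (with Shimura's existence theorem: such simple degenerate
  abelian varieties with `Bᵖ ≠ Dᵖ` EXIST for every such `ℓ` — Rem. 4.10's "nondivisorial Hodge cycle on `A`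
  itself", constructively).

NOT here: the `ℚ(ζ₃₁)` examples of §6 and the counts of Thm. 4.8 (sequel files); "`N`-dominated" /
"`h`-degenerate" as notions ([1], [3] of the paper; rendered by their content: codimension-`p` exceptional classes,
rank defect `q − 1`).

## References

* [Hazama2003CyclicCM] F. Hazama, J. Math. Sci. Univ. Tokyo 10 (2003) 581–598, Thm. 4.8, §5, Rem. 4.9–4.10, §6.
* [Gordon1999HodgeAVSurvey] B. B. Gordon, *A survey of the Hodge conjecture for abelian varieties*, 9.2, 9.2.2,
  9.4.1–9.4.2, Thm. 6.4, §9.3.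
* [Kubota1965] T. Kubota, Trans. AMS 118 (1965), §4 Lemma 2.
* [Shimura1998] G. Shimura, *Abelian Varieties with Complex Multiplication and Modular Functions*, §8.2 Prop. 26,
  §6.2 Thm. 3.
* [Pohlmann1968] H. Pohlmann, Ann. of Math. 88 (1968), Thm. 1 and §3.

## Provenance

Cell `pub-hodgecm2` (COR-CM), literature seat `lit-deligne-3` gen 18 (claim HAZAMA-CYCLIC-2PQ; count-neutral).
-/

set_option autoImplicit false

noncomputable section

open scoped BigOperators NumberField
open CategoryTheory NumberField

namespace Literature.AlgebraicGeometry.ComplexMultiplication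

namespace CyclotomicTwoOddPrimes

open Literature.NumberTheory.ComplexMultiplication
open Literature.NumberTheory.ComplexMultiplication.CyclicCMType
open Literature.AlgebraicGeometry.Motives (AbelianVariety CMType)
open Literature.AlgebraicGeometry.HodgeTheory
open Literature.AlgebraicGeometry.Pohlmann1968 Literature.AlgebraicGeometry.Pohlmann1968.Cyclotomic
open Literature.AlgebraicGeometry.ComplexMultiplication.CyclotomicCMTypeResidueSets
open Literature.Barriers.HodgeConjecture (divisorClassesSpan)

/-- `𝓤[ℓ, S] = {u ∈ (ℤ/ℓ)ˣ : u mod ℓ ∈ S}`, the CM residue set `S` seen in the unit group (local notation). -/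
local notation3 "𝓤[" ℓ ", " S "]" =>
  Finset.filter (fun u : (ZMod ℓ)ˣ => ((u : (ZMod ℓ)ˣ) : ZMod ℓ) ∈ S) Finset.univ

/-! ## §1 The frame `((ℤ/ℓ)ˣ; ρ = −1, τ, κ)` for a prime `ℓ = 2pq + 1` -/

section Frame

variable {ℓ p q : ℕ} [hℓp : Fact ℓ.Prime]

/-- For a prime `ℓ = 2pq + 1` (`p ≠ q` odd primes) and units `τ`, `κ` of orders `p`, `q`, the group `(ℤ/ℓ)ˣ`
(`= Gal(ℚ(ζ_ℓ)/ℚ)`, cyclic of order `2pq`) with `ρ = −1` (complex conjugation) is a frame in the sense of the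
group-level file. [cite: Hazama2003CyclicCM, §2 and §6] -/
theorem cyclicFrame_units (hp : p.Prime) (hq : q.Prime) (hpq : p ≠ q) (hp2 : p ≠ 2) (hq2 : q ≠ 2)
    (hℓ : ℓ = 2 * (p * q) + 1) {τ κ : (ZMod ℓ)ˣ} (hτ : orderOf τ = p) (hκ : orderOf κ = q) :
    CyclicFrame p q (-1 : (ZMod ℓ)ˣ) τ κ where
  prime_left := hp
  prime_right := hq
  ne := hpq
  left_ne_two := hp2
  right_ne_two := hq2
  rho_ne_one := by
    have h3p : 3 ≤ p := by have := hp.two_le; omega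
    have h3q : 3 ≤ q := by have := hq.two_le; omega
    have h9 : 9 ≤ p * q := Nat.mul_le_mul h3p h3q
    haveI : Fact (2 < ℓ) := ⟨by omega⟩
    intro h
    apply ZMod.neg_one_ne_one (n := ℓ)
    have h' := congrArg (fun u : (ZMod ℓ)ˣ => (u : ZMod ℓ)) h
    simpa using h'
  rho_mul_rho := by rw [neg_mul_neg, one_mul]
  orderOf_tau := hτ
  orderOf_kappa := hκ
  card_eq := by rw [ZMod.card_units ℓ, hℓ, Nat.add_sub_cancel]

/-- The frame from explicit units: `τ^p = 1 ≠ τ`, `κ^q = 1 ≠ κ`. [cite: Hazama2003CyclicCM, §2 and §6] -/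
theorem cyclicFrame_units_of_pow_eq_one (hp : p.Prime) (hq : q.Prime) (hpq : p ≠ q) (hp2 : p ≠ 2) (hq2 : q ≠ 2)
    (hℓ : ℓ = 2 * (p * q) + 1) {τ κ : (ZMod ℓ)ˣ} (hτp : τ ^ p = 1) (hτ1 : τ ≠ 1) (hκq : κ ^ q = 1)
    (hκ1 : κ ≠ 1) : CyclicFrame p q (-1 : (ZMod ℓ)ˣ) τ κ :=
  haveI := Fact.mk hp
  haveI := Fact.mk hq
  cyclicFrame_units hp hq hpq hp2 hq2 hℓ (orderOf_eq_prime hτp hτ1) (orderOf_eq_prime hκq hκ1)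

/-- **Frames exist** on `(ℤ/ℓ)ˣ` for every prime `ℓ = 2pq + 1` (Cauchy: units of orders `p` and `q`).
[cite: Hazama2003CyclicCM, §2] -/
theorem exists_cyclicFrame_units (hp : p.Prime) (hq : q.Prime) (hpq : p ≠ q) (hp2 : p ≠ 2) (hq2 : q ≠ 2)
    (hℓ : ℓ = 2 * (p * q) + 1) : ∃ τ κ : (ZMod ℓ)ˣ, CyclicFrame p q (-1 : (ZMod ℓ)ˣ) τ κ := by
  haveI := Fact.mk hp
  haveI := Fact.mk hq
  have hcard : Fintype.card (ZMod ℓ)ˣ = 2 * (p * q) := by rw [ZMod.card_units ℓ, hℓ, Nat.add_sub_cancel]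
  obtain ⟨τ, hτ⟩ := exists_prime_orderOf_dvd_card p
    (show p ∣ Fintype.card (ZMod ℓ)ˣ by rw [hcard]; exact dvd_mul_of_dvd_right (dvd_mul_right p q) 2)
  obtain ⟨κ, hκ⟩ := exists_prime_orderOf_dvd_card q
    (show q ∣ Fintype.card (ZMod ℓ)ˣ by rw [hcard]; exact dvd_mul_of_dvd_right (dvd_mul_left q p) 2)
  exact ⟨τ, κ, cyclicFrame_units hp hq hpq hp2 hq2 hℓ hτ hκ⟩

end Frame

/-! ## §2 Hazama's conditions read on residues -/

section Residues

variable {ℓ : ℕ} [NeZero ℓ] {p q : ℕ} {τ κ : (ZMod ℓ)ˣ} {S : Finset (ZMod ℓ)}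

/-- Membership in `𝓤[ℓ, S]`. [cite: Hazama2003CyclicCM, §6] -/
theorem mem_unitsFilter_iff (u : (ZMod ℓ)ˣ) : u ∈ 𝓤[ℓ, S] ↔ (u : ZMod ℓ) ∈ S := by
  simp only [Finset.mem_filter, Finset.mem_univ, true_and]

/-- A unit residue `c` is the value of the unit `unitOfCoprime c`. [cite: Washington1997, Thm. 2.5] -/
theorem coe_unitOfCoprime_of_mem {c : ZMod ℓ} (hc : c ∈ unitResidues ℓ) :
    ((ZMod.unitOfCoprime c.val ((coprime_iff_mem_unitResidues ℓ c).2 hc) : (ZMod ℓ)ˣ) : ZMod ℓ) = c := by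
  rw [ZMod.coe_unitOfCoprime, ZMod.natCast_zmod_val]

/-- The value of a unit is a unit residue. [cite: Washington1997, Thm. 2.5] -/
theorem coe_mem_unitResidues (u : (ZMod ℓ)ˣ) : (u : ZMod ℓ) ∈ unitResidues ℓ :=
  (coprime_iff_mem_unitResidues ℓ _).1 (ZMod.val_coe_unit_coprime u)

/-- **Row counts on residues**: `#{x ∈ ℤ/p : τˣκʸ ∈ 𝓤[ℓ,S]} = #{x ∈ ℤ/p : τˣκʸ mod ℓ ∈ S}` (a finite check on
`ℤ/ℓ`). [cite: Hazama2003CyclicCM, Prop. 4.3] -/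
theorem rowCount_eq_card_filter [NeZero p] (y : ZMod q) :
    rowCount p q 𝓤[ℓ, S] τ κ y =
      (Finset.univ.filter fun x : ZMod p => (τ : ZMod ℓ) ^ x.val * (κ : ZMod ℓ) ^ y.val ∈ S).card := by
  unfold rowCount
  congr 1
  ext x
  simp only [Finset.mem_filter, Finset.mem_univ, true_and, Units.val_mul, Units.val_pow_eq_pow_val]

/-- **`S ∈ S_p` read on residues**: constant row counts `#{x : τˣκʸ mod ℓ ∈ S}`, `y ∈ ℤ/q`.
[cite: Hazama2003CyclicCM, Prop. 4.3 and Thm. 4.8 (ii)] -/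
theorem hasConstantRows_iff_card_filter [NeZero p] :
    HasConstantRows p q 𝓤[ℓ, S] τ κ ↔ ∀ y y' : ZMod q,
      (Finset.univ.filter fun x : ZMod p => (τ : ZMod ℓ) ^ x.val * (κ : ZMod ℓ) ^ y.val ∈ S).card =
        (Finset.univ.filter fun x : ZMod p => (τ : ZMod ℓ) ^ x.val * (κ : ZMod ℓ) ^ y'.val ∈ S).card := by
  unfold HasConstantRows
  simp only [rowCount_eq_card_filter]

/-- **Stability read on residues**: `u` stabilises `𝓤[ℓ,S]` iff `c ∈ S ↔ uc ∈ S` for every unit residue `c`.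
[cite: Hazama2003CyclicCM, Prop. 2.3] -/
theorem isStableUnder_iff (u : (ZMod ℓ)ˣ) :
    IsStableUnder 𝓤[ℓ, S] u ↔ ∀ c ∈ unitResidues ℓ, (c ∈ S ↔ (u : ZMod ℓ) * c ∈ S) := by
  unfold IsStableUnder
  simp only [mem_unitsFilter_iff, Units.val_mul]
  constructor
  · intro H c hc
    have h := H (ZMod.unitOfCoprime c.val ((coprime_iff_mem_unitResidues ℓ c).2 hc))
    rwa [coe_unitOfCoprime_of_mem hc] at h
  · intro H s
    exact H _ (coe_mem_unitResidues s)

/-- **Primitivity read on the unit group**: the residue set `S` has trivial stabiliser (no unit `t ≠ 1` with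
`S·t = S`, the tree's `HasTrivialStabilizer`) iff no `u ≠ 1` in `(ℤ/ℓ)ˣ` stabilises `𝓤[ℓ,S]` (Hazama's "primitive",
Prop. 2.3). [cite: Hazama2003CyclicCM, Prop. 2.3 and Thm. 4.8 (iii)] [cite: Shimura1998, §8.2 Prop. 26] -/
theorem hasTrivialStabilizer_iff :
    HasTrivialStabilizer ℓ S ↔ ∀ u : (ZMod ℓ)ˣ, u ≠ 1 → ¬ IsStableUnder 𝓤[ℓ, S] u := by
  constructor
  · intro H u hu1 hst
    rw [isStableUnder_iff] at hst
    apply hu1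
    have h1 : (u : ZMod ℓ) = 1 := H _ (coe_mem_unitResidues u) fun c hc => by
      rw [mul_comm]; exact (hst c hc).symm
    exact Units.ext (by rw [h1, Units.val_one])
  · intro H t ht hstab
    by_contra ht1
    set u : (ZMod ℓ)ˣ := ZMod.unitOfCoprime t.val ((coprime_iff_mem_unitResidues ℓ t).2 ht) with hu
    have hut : (u : ZMod ℓ) = t := coe_unitOfCoprime_of_mem ht
    refine H u (fun h1 => ht1 ?_) ((isStableUnder_iff u).2 fun c hc => ?_)
    · rw [← hut, h1, Units.val_one]
    · rw [hut, mul_comm]; exact (hstab c hc).symm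

/-- **Primitive types separate the units** (the hypothesis `hsep` of the tree's transport lemmas
`isPrimitive_of_residues`, `exists_exceptional_of_residues`): if no `u ≠ 1` stabilises `𝓤[ℓ,S]`, two units with the
same pattern of translates in `S` are equal (`t = b a⁻¹` stabilises). [cite: Hazama2003CyclicCM, Prop. 2.3]
[cite: Shimura1998, §8.2 Prop. 26] -/
theorem separating_of_forall_not_isStableUnder (H : ∀ u : (ZMod ℓ)ˣ, u ≠ 1 → ¬ IsStableUnder 𝓤[ℓ, S] u) :
    ∀ a ∈ unitResidues ℓ, ∀ b ∈ unitResidues ℓ, (∀ u ∈ unitResidues ℓ, (u * a ∈ S ↔ u * b ∈ S)) → a = b := by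
  intro a ha b hb hab
  set ua : (ZMod ℓ)ˣ := ZMod.unitOfCoprime a.val ((coprime_iff_mem_unitResidues ℓ a).2 ha)
  set ub : (ZMod ℓ)ˣ := ZMod.unitOfCoprime b.val ((coprime_iff_mem_unitResidues ℓ b).2 hb)
  have hua : (ua : ZMod ℓ) = a := coe_unitOfCoprime_of_mem ha
  have hub : (ub : ZMod ℓ) = b := coe_unitOfCoprime_of_mem hb
  by_contra hne
  refine H (ub * ua⁻¹) (fun h1 => hne ?_) ((isStableUnder_iff _).2 fun c hc => ?_)
  · rw [mul_inv_eq_one] at h1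
    rw [← hua, ← hub, h1]
  · -- `c ∈ S ↔ (b a⁻¹) c ∈ S` from the hypothesis at `u = c a⁻¹`
    have hu : c * ((ua⁻¹ : (ZMod ℓ)ˣ) : ZMod ℓ) ∈ unitResidues ℓ := by
      have : c * ((ua⁻¹ : (ZMod ℓ)ˣ) : ZMod ℓ) =
          ((ZMod.unitOfCoprime c.val ((coprime_iff_mem_unitResidues ℓ c).2 hc) * ua⁻¹ : (ZMod ℓ)ˣ) : ZMod ℓ) := by
        rw [Units.val_mul, coe_unitOfCoprime_of_mem hc]
      rw [this]
      exact coe_mem_unitResidues _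
    have key := hab _ hu
    have e1 : c * ((ua⁻¹ : (ZMod ℓ)ˣ) : ZMod ℓ) * a = c := by
      rw [← hua, mul_assoc, ← Units.val_mul, inv_mul_cancel, Units.val_one, mul_one]
    have e2 : c * ((ua⁻¹ : (ZMod ℓ)ˣ) : ZMod ℓ) * b = ((ub * ua⁻¹ : (ZMod ℓ)ˣ) : ZMod ℓ) * c := by
      rw [← hub, Units.val_mul]; ring
    rw [e1, e2] at key
    exact key

/-- The separation hypothesis from a trivial stabiliser. [cite: Shimura1998, §8.2 Prop. 26] -/
theorem separating_of_hasTrivialStabilizer (H : HasTrivialStabilizer ℓ S) :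
    ∀ a ∈ unitResidues ℓ, ∀ b ∈ unitResidues ℓ, (∀ u ∈ unitResidues ℓ, (u * a ∈ S ↔ u * b ∈ S)) → a = b :=
  separating_of_forall_not_isStableUnder (hasTrivialStabilizer_iff.1 H)

end Residues

/-! ## §3 Theorem 4.8 for the CM types `Φ_S` of `ℚ(ζ_ℓ)` -/

section Field

variable {ℓ : ℕ} [NeZero ℓ] {p q : ℕ} {τ κ : (ZMod ℓ)ˣ}
variable (L : Type) [Field L] [NumberField L] [IsCyclotomicExtension {ℓ} ℚ L]
variable {S : Finset (ZMod ℓ)}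

/-- `[ℚ(ζ_ℓ) : ℚ]/2 = pq` on a frame of `(ℤ/ℓ)ˣ`. [cite: Washington1997, Thm. 2.5] -/
theorem finrank_div_two_eq (hF : CyclicFrame p q (-1 : (ZMod ℓ)ˣ) τ κ) : Module.finrank ℚ L / 2 = p * q := by
  rw [finrank_eq_totient ℓ L, ← ZMod.card_units_eq_totient ℓ, hF.card_eq, Nat.mul_div_cancel_left _ two_pos]

/-- `ℓ > 2` on a frame (`|(ℤ/ℓ)ˣ| = 2pq ≥ 18`). [cite: Hazama2003CyclicCM, §2] -/
theorem two_lt_of_cyclicFrame (hF : CyclicFrame p q (-1 : (ZMod ℓ)ˣ) τ κ) : 2 < ℓ := by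
  have h3p : 3 ≤ p := by have := hF.prime_left.two_le; have := hF.left_ne_two; omega
  have h3q : 3 ≤ q := by have := hF.prime_right.two_le; have := hF.right_ne_two; omega
  have h9 : 9 ≤ p * q := Nat.mul_le_mul h3p h3q
  have hle : Fintype.card (ZMod ℓ)ˣ ≤ Fintype.card (ZMod ℓ) :=
    Fintype.card_le_of_injective (fun u : (ZMod ℓ)ˣ => (u : ZMod ℓ)) fun _ _ h => Units.ext h
  rw [hF.card_eq, ZMod.card] at hle
  omega

/-- `ℚ(ζ_ℓ)` is a CM field on a frame (`ℓ > 2`, Mathlib). [folklore] -/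
private theorem isCMField_of_cyclicFrame (hF : CyclicFrame p q (-1 : (ZMod ℓ)ˣ) τ κ) : IsCMField L :=
  IsCyclotomicExtension.Rat.isCMField L (S := {ℓ}) ⟨ℓ, rfl, two_lt_of_cyclicFrame hF⟩

/-- The rank of `Φ_S` is the group-level rank of `𝓤[ℓ,S]`, and the nondegeneracy target is `pq + 1`.
[cite: Gordon1999HodgeAVSurvey, §9.4.1–9.4.2] [cite: Kubota1965, §2 (p. 115)] -/
theorem isNondegenerate_iff_typeRank_eq (hF : CyclicFrame p q (-1 : (ZMod ℓ)ˣ) τ κ)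
    (hS : ∀ c : ZMod ℓ, c.val.Coprime ℓ → (c ∈ S ↔ -c ∉ S)) :
    IsNondegenerate (cmTypeOfResidues (L := L) S hS) ↔
      typeRank (ZMod ℓ)ˣ (↑𝓤[ℓ, S] : Set (ZMod ℓ)ˣ) = p * q + 1 := by
  rw [isNondegenerate_iff, CyclotomicFermatCMType.cmTypeRank_cmTypeOfResidues_eq ℓ L hS, finrank_div_two_eq L hF]

/-- **THEOREM 4.8 (ii) for `ℚ(ζ_ℓ)`: `Deg = S₁ ∪ S_p ∪ S_q`.**  The CM type `Φ_S` of `ℚ(ζ_ℓ)`, `ℓ − 1 = 2pq`, is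
DEGENERATE iff `S` has constant row counts (`S ∈ S_p`), or constant column counts (`S ∈ S_q`), or is stable under
the unit `τ` of order `p` or the unit `κ` of order `q` (`S ∈ S₁`, non-primitive).
[cite: Hazama2003CyclicCM, Thm. 4.8 (ii)–(iii)] [cite: Kubota1965, §4 Lemma 2] -/
theorem not_isNondegenerate_iff (hF : CyclicFrame p q (-1 : (ZMod ℓ)ˣ) τ κ)
    (hS : ∀ c : ZMod ℓ, c.val.Coprime ℓ → (c ∈ S ↔ -c ∉ S)) :
    haveI : NeZero p := ⟨hF.prime_left.ne_zero⟩
    haveI : NeZero q := ⟨hF.prime_right.ne_zero⟩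
    ¬ IsNondegenerate (cmTypeOfResidues (L := L) S hS) ↔
      HasConstantRows p q 𝓤[ℓ, S] τ κ ∨ HasConstantRows q p 𝓤[ℓ, S] κ τ ∨
        IsStableUnder 𝓤[ℓ, S] τ ∨ IsStableUnder 𝓤[ℓ, S] κ := by
  rw [isNondegenerate_iff_typeRank_eq L hF hS]
  exact typeRank_ne_iff hF (CyclotomicFermatCMType.isCMTypeWith_unitsFilter ℓ hS)

/-- **THEOREM 4.8 (ii), nondegenerate form**: `Φ_S` is nondegenerate iff none of the four conditions holds.
[cite: Hazama2003CyclicCM, Thm. 4.8 (ii)] -/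
theorem isNondegenerate_iff (hF : CyclicFrame p q (-1 : (ZMod ℓ)ˣ) τ κ)
    (hS : ∀ c : ZMod ℓ, c.val.Coprime ℓ → (c ∈ S ↔ -c ∉ S)) :
    haveI : NeZero p := ⟨hF.prime_left.ne_zero⟩
    haveI : NeZero q := ⟨hF.prime_right.ne_zero⟩
    IsNondegenerate (cmTypeOfResidues (L := L) S hS) ↔
      ¬ HasConstantRows p q 𝓤[ℓ, S] τ κ ∧ ¬ HasConstantRows q p 𝓤[ℓ, S] κ τ ∧
        ¬ IsStableUnder 𝓤[ℓ, S] τ ∧ ¬ IsStableUnder 𝓤[ℓ, S] κ := by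
  rw [isNondegenerate_iff_typeRank_eq L hF hS]
  exact typeRank_eq_iff hF (CyclotomicFermatCMType.isCMTypeWith_unitsFilter ℓ hS)

/-- **THEOREM 4.8 (iii) for `ℚ(ζ_ℓ)`: primitivity.**  `Φ_S` is PRIMITIVE (the tree's `IsPrimitive`, Shimura §8.2
Prop. 26, at any base embedding) iff no unit `u ≠ 1` stabilises `𝓤[ℓ,S]` — equivalently (Prop. 2.3,
`exists_isStableUnder_iff`) iff neither `τ` nor `κ` does. [cite: Hazama2003CyclicCM, Thm. 4.8 (iii) and Prop. 2.3]
[cite: Shimura1998, §8.2 Prop. 26] -/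
theorem isPrimitive_iff (hSc : IsCMResidueSet ℓ S) (hS : ∀ c : ZMod ℓ, c.val.Coprime ℓ → (c ∈ S ↔ -c ∉ S))
    (φ₀ : L →+* ℂ) :
    IsPrimitive (ℂ ≃+* ℂ) (cmTypeOfResidues (L := L) S hS).1 φ₀ ↔
      ∀ u : (ZMod ℓ)ˣ, u ≠ 1 → ¬ IsStableUnder 𝓤[ℓ, S] u := by
  rw [isPrimitive_iff_hasTrivialStabilizer ℓ _ φ₀, residueSet_cmTypeOfResidues ℓ hSc, hasTrivialStabilizer_iff]

/-- Primitivity through `τ` and `κ` only (Prop. 2.3: a stabiliser `≠ 1` exists iff one of order `p` or `q` does).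
[cite: Hazama2003CyclicCM, Prop. 2.3 and Thm. 4.8 (iii)] -/
theorem isPrimitive_iff_not_isStableUnder (hF : CyclicFrame p q (-1 : (ZMod ℓ)ˣ) τ κ) (hSc : IsCMResidueSet ℓ S)
    (hS : ∀ c : ZMod ℓ, c.val.Coprime ℓ → (c ∈ S ↔ -c ∉ S)) (φ₀ : L →+* ℂ) :
    IsPrimitive (ℂ ≃+* ℂ) (cmTypeOfResidues (L := L) S hS).1 φ₀ ↔
      ¬ IsStableUnder 𝓤[ℓ, S] τ ∧ ¬ IsStableUnder 𝓤[ℓ, S] κ := by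
  rw [isPrimitive_iff L hSc hS φ₀]
  have key := exists_isStableUnder_iff hF (CyclotomicFermatCMType.isCMTypeWith_unitsFilter ℓ hS)
  constructor
  · intro H
    have : ¬ ∃ u : (ZMod ℓ)ˣ, u ≠ 1 ∧ IsStableUnder 𝓤[ℓ, S] u := fun ⟨u, hu1, hu⟩ => H u hu1 hu
    rw [key] at this
    push Not at this
    exact this
  · rintro ⟨hτ, hκ⟩ u hu1 hu
    have : ∃ u : (ZMod ℓ)ˣ, u ≠ 1 ∧ IsStableUnder 𝓤[ℓ, S] u := ⟨u, hu1, hu⟩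
    rw [key] at this
    exact this.elim hτ hκ

/-- **THEOREM 4.8 (ii)+(iii)+(iv)+(v) for `ℚ(ζ_ℓ)`: the PRIMITIVE DEGENERATE types are `(S_p − S₁) ⊔ (S_q − S₁)`.**
A primitive `Φ_S` is degenerate iff EXACTLY ONE of "constant rows" (`p`-dominated) / "constant columns"
(`q`-dominated) holds. [cite: Hazama2003CyclicCM, Thm. 4.8 (ii)–(v) and Prop. 4.5] -/
theorem not_isNondegenerate_iff_of_primitive (hF : CyclicFrame p q (-1 : (ZMod ℓ)ˣ) τ κ)
    (hS : ∀ c : ZMod ℓ, c.val.Coprime ℓ → (c ∈ S ↔ -c ∉ S))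
    (hprim : ∀ u : (ZMod ℓ)ˣ, u ≠ 1 → ¬ IsStableUnder 𝓤[ℓ, S] u) :
    haveI : NeZero p := ⟨hF.prime_left.ne_zero⟩
    haveI : NeZero q := ⟨hF.prime_right.ne_zero⟩
    ¬ IsNondegenerate (cmTypeOfResidues (L := L) S hS) ↔
      (HasConstantRows p q 𝓤[ℓ, S] τ κ ∧ ¬ HasConstantRows q p 𝓤[ℓ, S] κ τ) ∨
        (HasConstantRows q p 𝓤[ℓ, S] κ τ ∧ ¬ HasConstantRows p q 𝓤[ℓ, S] τ κ) := by
  rw [isNondegenerate_iff_typeRank_eq L hF hS]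
  exact typeRank_ne_iff_of_primitive hF (CyclotomicFermatCMType.isCMTypeWith_unitsFilter ℓ hS) hprim

/-- A `p`-dominated (`S ∈ S_p`) type is degenerate. [cite: Hazama2003CyclicCM, Prop. 4.3 and Thm. 4.8 (ii)] -/
theorem not_isNondegenerate_of_hasConstantRows (hF : CyclicFrame p q (-1 : (ZMod ℓ)ˣ) τ κ)
    (hS : ∀ c : ZMod ℓ, c.val.Coprime ℓ → (c ∈ S ↔ -c ∉ S))
    (hr : haveI : NeZero p := ⟨hF.prime_left.ne_zero⟩; HasConstantRows p q 𝓤[ℓ, S] τ κ) :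
    ¬ IsNondegenerate (cmTypeOfResidues (L := L) S hS) :=
  (not_isNondegenerate_iff L hF hS).2 (Or.inl hr)

end Field

/-! ## §4 On abelian varieties of type `(ℚ(ζ_ℓ); Φ_S)` -/

section AbelianVarieties

variable {ℓ : ℕ} [NeZero ℓ] {p q : ℕ} {τ κ : (ZMod ℓ)ˣ}
variable {L : Type} [Field L] [NumberField L] [IsCyclotomicExtension {ℓ} ℚ L]
variable {S : Finset (ZMod ℓ)} {hS : ∀ c : ZMod ℓ, c.val.Coprime ℓ → (c ∈ S ↔ -c ∉ S)}
variable {A : AbelianVariety ℂ} {ι : 𝓞 L →+* End A} {θ : L →+* Module.End ℂ (complexBetti A.X 1)}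

/-- **`dim A = pq`** for an abelian variety of CM type `(ℚ(ζ_ℓ); Φ_S)`, `ℓ − 1 = 2pq`.
[cite: Shimura1998, §6.2 Theorem 3] [cite: Hazama2003CyclicCM, Rem. 4.10] -/
theorem dim_eq (hF : CyclicFrame p q (-1 : (ZMod ℓ)ˣ) τ κ)
    (hA : IsCMTypeRealisation (cmTypeOfResidues (L := L) S hS) A ι θ) : A.dim = p * q := by
  rw [dim_eq_of_realisation (N := ℓ) hA, ← ZMod.card_units_eq_totient ℓ, hF.card_eq, Nat.mul_div_cancel_left _ two_pos]

/-- **Primitive ⟹ simple**: if no unit `≠ 1` stabilises `𝓤[ℓ,S]`, every abelian variety of type `Φ_S` is simple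
("the abelian variety `A_S` associated to it is absolutely simple", §6; Shimura §8.2 Prop. 26).
[cite: Hazama2003CyclicCM, §6 (p. 597)] [cite: Shimura1998, §8.2 Prop. 26] -/
theorem isSimple_of_forall_not_isStableUnder (hprim : ∀ u : (ZMod ℓ)ˣ, u ≠ 1 → ¬ IsStableUnder 𝓤[ℓ, S] u)
    (hA : IsCMTypeRealisation (cmTypeOfResidues (L := L) S hS) A ι θ) : A.IsSimple :=
  isSimple_of_residues (unitResidues ℓ) (coprime_iff_mem_unitResidues ℓ)
    (separating_of_forall_not_isStableUnder hprim) hA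

/-- The image of a set of units in `ℤ/ℓ` consists of unit residues. [cite: Washington1997, Thm. 2.5] -/
theorem image_val_subset_unitResidues (Δ : Finset (ZMod ℓ)ˣ) :
    Δ.image (fun u : (ZMod ℓ)ˣ => (u : ZMod ℓ)) ⊆ unitResidues ℓ := by
  intro c hc
  obtain ⟨u, -, rfl⟩ := Finset.mem_image.1 hc
  exact coe_mem_unitResidues u

/-- Counting a translate condition on the image of a set of units. [cite: Gordon1999HodgeAVSurvey, §9.2 (9.2.1)] -/
theorem card_filter_image_val (Δ : Finset (ZMod ℓ)ˣ) (g : (ZMod ℓ)ˣ) :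
    ((Δ.image fun u : (ZMod ℓ)ˣ => (u : ZMod ℓ)).filter fun c => (g : ZMod ℓ) * c ∈ S).card =
      (Δ.filter fun d => g * d ∈ 𝓤[ℓ, S]).card := by
  rw [Finset.filter_image, Finset.card_image_of_injective _ fun _ _ h => Units.ext h]
  congr 1
  ext d
  simp only [Finset.mem_filter, Finset.mem_univ, true_and, Units.val_mul]

/-- **A balanced set of units gives a balanced residue set** (the hypothesis `hbal` of the tree's transport lemma
`exists_exceptional_of_residues`, from the group-level `IsBalanced` in indicator form).
[cite: Gordon1999HodgeAVSurvey, §9.2 (9.2.1)] -/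
theorem balanced_image_val_of_isBalanced {Δ : Finset (ZMod ℓ)ˣ}
    (hbal : IsBalanced (ZMod ℓ)ˣ (↑𝓤[ℓ, S] : Set (ZMod ℓ)ˣ) (fun d => if d ∈ Δ then (1 : ℚ) else 0)) :
    ∀ u ∈ unitResidues ℓ,
      2 * ((Δ.image fun u : (ZMod ℓ)ˣ => (u : ZMod ℓ)).filter fun c => u * c ∈ S).card =
        (Δ.image fun u : (ZMod ℓ)ˣ => (u : ZMod ℓ)).card := by
  rw [isBalanced_indicator_iff] at hbal
  intro u hu
  rw [Finset.card_image_of_injective _ fun _ _ h => Units.ext h, ← hbal (ZMod.unitOfCoprime u.val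
    ((coprime_iff_mem_unitResidues ℓ u).2 hu)), ← card_filter_image_val, coe_unitOfCoprime_of_mem hu]

/-- **THEOREM 4.8 (iv) with §5 and Pohlmann's criterion: exceptional Hodge classes of codimension `p` on the
`p`-dominated abelian varieties.**  If `S` is PRIMITIVE (no unit `≠ 1` stabilises `𝓤[ℓ,S]`) and `p`-DOMINATED
(constant row counts), then EVERY abelian variety `A` of CM type `(ℚ(ζ_ℓ); Φ_S)` — a simple abelian variety of
dimension `pq` — carries a rational `(p,p)`-class OUTSIDE `Dᵖ(A) ⊗ ℂ`: a nondivisorial Hodge cycle of codimension `p`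
on `A` itself (Rem. 4.10), from the weight-`p` height-one kernel elements of §5 (the balanced sets
`Δ(0, 1) = {τˣ} ∪ {ρτˣκ}` of the group-level file, `isBalanced_hazamaSet`, transported by the tree's
`exists_exceptional_of_residues` = Gordon 9.2.2 for primitive types).
[cite: Hazama2003CyclicCM, Thm. 4.8 (iv), §5 (p. 596–597) and Rem. 4.10] [cite: Gordon1999HodgeAVSurvey, 9.2.2]
[cite: Pohlmann1968, Thm. 1 and §3] -/
theorem exists_exceptional_of_hasConstantRows (hF : CyclicFrame p q (-1 : (ZMod ℓ)ˣ) τ κ)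
    (hprim : ∀ u : (ZMod ℓ)ˣ, u ≠ 1 → ¬ IsStableUnder 𝓤[ℓ, S] u)
    (hr : haveI : NeZero p := ⟨hF.prime_left.ne_zero⟩; HasConstantRows p q 𝓤[ℓ, S] τ κ)
    (hA : IsCMTypeRealisation (cmTypeOfResidues (L := L) S hS) A ι θ) :
    ∃ c : complexBetti A.X (2 * p), IsRationalClass c ∧ IsOfHodgeType (p * q) A.X (2 * p) p p c ∧
      c ∉ divisorClassesSpan A.X (p * q) p := by
  haveI : NeZero p := ⟨hF.prime_left.ne_zero⟩
  haveI : NeZero q := ⟨hF.prime_right.ne_zero⟩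
  haveI : Fact (1 < q) := ⟨hF.prime_right.one_lt⟩
  have h := CyclotomicFermatCMType.isCMTypeWith_unitsFilter ℓ hS
  have hy : (0 : ZMod q) ≠ 1 := zero_ne_one
  -- Hazama's weight-`p` kernel element `Δ(0,1)`, as a set of `2p` units, and its image `P` in `ℤ/ℓ`
  set Δ : Finset (ZMod ℓ)ˣ := hazamaSet p (-1 : (ZMod ℓ)ˣ) τ κ (0 : ZMod q) 1 with hΔ
  set P : Finset (ZMod ℓ) := Δ.image fun u : (ZMod ℓ)ˣ => (u : ZMod ℓ) with hP
  have hPcard : P.card = 2 * p := by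
    rw [hP, Finset.card_image_of_injective _ fun _ _ h => Units.ext h, hΔ, card_hazamaSet hF]
  have hbal := balanced_image_val_of_isBalanced (S := S) (isBalanced_hazamaSet hF h hr 0 1)
  have hns : ∃ c ∈ P, -c ∉ P := by
    obtain ⟨d, hd, hnd⟩ := exists_mem_hazamaSet_rho_mul_not_mem hF hy
    refine ⟨(d : ZMod ℓ), Finset.mem_image_of_mem _ hd, fun hc => hnd ?_⟩
    obtain ⟨d', hd', hdd'⟩ := Finset.mem_image.1 hc
    have : d' = -1 * d := Units.ext (by rw [hdd', Units.val_mul, Units.val_neg, Units.val_one, neg_one_mul])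
    rw [← this]
    exact hd'
  have key := exists_exceptional_of_residues (unitResidues ℓ) (coprime_iff_mem_unitResidues ℓ)
    (two_lt_of_cyclicFrame hF) (separating_of_forall_not_isStableUnder hprim) (image_val_subset_unitResidues Δ)
    hbal hns hPcard hA
  rwa [finrank_div_two_eq L hF] at key

/-- **THEOREM 4.8 (v): the `q`-dominated case** — a primitive `S` with constant COLUMN counts forces a rational
`(q,q)`-class outside `D^q(A) ⊗ ℂ` on every `A` of type `Φ_S`. [cite: Hazama2003CyclicCM, Thm. 4.8 (v) and §5]
[cite: Gordon1999HodgeAVSurvey, 9.2.2] -/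
theorem exists_exceptional_of_hasConstantCols (hF : CyclicFrame p q (-1 : (ZMod ℓ)ˣ) τ κ)
    (hprim : ∀ u : (ZMod ℓ)ˣ, u ≠ 1 → ¬ IsStableUnder 𝓤[ℓ, S] u)
    (hc : haveI : NeZero q := ⟨hF.prime_right.ne_zero⟩; HasConstantRows q p 𝓤[ℓ, S] κ τ)
    (hA : IsCMTypeRealisation (cmTypeOfResidues (L := L) S hS) A ι θ) :
    ∃ c : complexBetti A.X (2 * q), IsRationalClass c ∧ IsOfHodgeType (p * q) A.X (2 * q) q q c ∧
      c ∉ divisorClassesSpan A.X (p * q) q := by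
  rw [mul_comm p q]
  exact exists_exceptional_of_hasConstantRows hF.swap hprim hc hA

/-- **REMARK 4.10 for the fields `ℚ(ζ_ℓ)`, `ℓ − 1 = 2pq`, constructively** (Lenstra, via White [7]: "for any
abelian variety `A` with complex multiplication by an abelian CM-field, there always exists a nondivisorial Hodge
cycle on `A` itself if `A` is degenerate"): if `Φ_S` is PRIMITIVE and DEGENERATE then — `S` being `p`- or
`q`-dominated by Thm. 4.8 — every `A` of type `Φ_S` carries a rational `(m,m)`-class outside `Dᵐ(A) ⊗ ℂ` for
`m = p` or `m = q`. [cite: Hazama2003CyclicCM, Rem. 4.10 and Thm. 4.8 (iv)–(v)] [cite: Gordon1999HodgeAVSurvey, 9.2.2] -/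
theorem exists_exceptional_of_not_isNondegenerate (hF : CyclicFrame p q (-1 : (ZMod ℓ)ˣ) τ κ)
    (hprim : ∀ u : (ZMod ℓ)ˣ, u ≠ 1 → ¬ IsStableUnder 𝓤[ℓ, S] u)
    (hdeg : ¬ IsNondegenerate (cmTypeOfResidues (L := L) S hS))
    (hA : IsCMTypeRealisation (cmTypeOfResidues (L := L) S hS) A ι θ) :
    ∃ m : ℕ, (m = p ∨ m = q) ∧ ∃ c : complexBetti A.X (2 * m), IsRationalClass c ∧
      IsOfHodgeType (p * q) A.X (2 * m) m m c ∧ c ∉ divisorClassesSpan A.X (p * q) m := by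
  rcases (not_isNondegenerate_iff_of_primitive L hF hS hprim).1 hdeg with ⟨hr, -⟩ | ⟨hc, -⟩
  · exact ⟨p, Or.inl rfl, exists_exceptional_of_hasConstantRows hF hprim hr hA⟩
  · exact ⟨q, Or.inr rfl, exists_exceptional_of_hasConstantCols hF hprim hc hA⟩

/-- **The nondegenerate side of THEOREM 4.8 (ii) on abelian varieties** (with White–Hazama, tree
`IsNondegenerate.hodgeConjectureFor_pow`): if `S ∉ S₁ ∪ S_p ∪ S_q` — no constant rows, no constant columns, not
stable under `τ` nor under `κ` — then EVERY power `Aᵏ` of EVERY abelian variety of CM type `(ℚ(ζ_ℓ); Φ_S)` satisfies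
the Hodge conjecture, unconditionally. [cite: Hazama2003CyclicCM, Thm. 4.8 (ii)] [cite: Gordon1999HodgeAVSurvey, Thm. 6.4 and §9.3] -/
theorem hodgeConjectureFor_pow_of_not_mem (hF : CyclicFrame p q (-1 : (ZMod ℓ)ˣ) τ κ)
    (hnr : haveI : NeZero p := ⟨hF.prime_left.ne_zero⟩; ¬ HasConstantRows p q 𝓤[ℓ, S] τ κ)
    (hnc : haveI : NeZero q := ⟨hF.prime_right.ne_zero⟩; ¬ HasConstantRows q p 𝓤[ℓ, S] κ τ)
    (hnτ : ¬ IsStableUnder 𝓤[ℓ, S] τ) (hnκ : ¬ IsStableUnder 𝓤[ℓ, S] κ)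
    (hA : IsCMTypeRealisation (cmTypeOfResidues (L := L) S hS) A ι θ) (k : ℕ) :
    HodgeConjectureFor (⨁ fun _ : Fin k => A).dim (⨁ fun _ : Fin k => A).X := by
  haveI := isCMField_of_cyclicFrame L hF
  exact ((isNondegenerate_iff L hF hS).2 ⟨hnr, hnc, hnτ, hnκ⟩).hodgeConjectureFor_pow hA k

/-- The same with simplicity: if moreover (automatically, Kubota) `Φ_S` is primitive, `A` is a SIMPLE abelian variety
of dimension `pq` all of whose powers satisfy the Hodge conjecture. [cite: Hazama2003CyclicCM, Thm. 4.8 (ii)]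
[cite: Gordon1999HodgeAVSurvey, Thm. 6.4 and §9.3] [cite: Kubota1965, §2 (p. 115)] -/
theorem isSimple_and_hodgeConjectureFor_pow_of_not_mem (hF : CyclicFrame p q (-1 : (ZMod ℓ)ˣ) τ κ)
    (hnr : haveI : NeZero p := ⟨hF.prime_left.ne_zero⟩; ¬ HasConstantRows p q 𝓤[ℓ, S] τ κ)
    (hnc : haveI : NeZero q := ⟨hF.prime_right.ne_zero⟩; ¬ HasConstantRows q p 𝓤[ℓ, S] κ τ)
    (hnτ : ¬ IsStableUnder 𝓤[ℓ, S] τ) (hnκ : ¬ IsStableUnder 𝓤[ℓ, S] κ)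
    (hA : IsCMTypeRealisation (cmTypeOfResidues (L := L) S hS) A ι θ) :
    A.IsSimple ∧ A.dim = p * q ∧ ∀ k : ℕ, HodgeConjectureFor (⨁ fun _ : Fin k => A).dim (⨁ fun _ : Fin k => A).X := by
  haveI := isCMField_of_cyclicFrame L hF
  have hnd := (isNondegenerate_iff L hF hS).2 ⟨hnr, hnc, hnτ, hnκ⟩
  obtain ⟨φ₀⟩ : Nonempty (L →+* ℂ) := inferInstance
  exact ⟨isSimple_of_isCMTypeRealisation_of_isPrimitive hA φ₀ (hnd.isPrimitive φ₀), dim_eq hF hA,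
    fun k => hnd.hodgeConjectureFor_pow hA k⟩

/-- **Realisations exist** (Shimura §6.2 Thm. 3 = tree `exists_isCMTypeRealisation`): for a primitive `p`-dominated
`S` there IS a simple abelian variety of dimension `pq` with complex multiplication by `ℚ(ζ_ℓ)`, of type `Φ_S`, whose
ring of Hodge classes is NOT generated by divisor classes — `Bᵖ(A) ⊗ ℂ ≠ Dᵖ(A) ⊗ ℂ`.
[cite: Hazama2003CyclicCM, Thm. 4.8 (iv) and Rem. 4.9–4.10] [cite: Shimura1998, §6.2 Theorem 3] -/
theorem exists_realisation_exceptional_of_hasConstantRows (hF : CyclicFrame p q (-1 : (ZMod ℓ)ˣ) τ κ)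
    (hS : ∀ c : ZMod ℓ, c.val.Coprime ℓ → (c ∈ S ↔ -c ∉ S))
    (hprim : ∀ u : (ZMod ℓ)ˣ, u ≠ 1 → ¬ IsStableUnder 𝓤[ℓ, S] u)
    (hr : haveI : NeZero p := ⟨hF.prime_left.ne_zero⟩; HasConstantRows p q 𝓤[ℓ, S] τ κ) :
    ∃ (B : AbelianVariety ℂ) (ι' : 𝓞 L →+* End B) (θ' : L →+* Module.End ℂ (complexBetti B.X 1)),
      IsCMTypeRealisation (cmTypeOfResidues (L := L) S hS) B ι' θ' ∧ B.IsSimple ∧ B.dim = p * q ∧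
        ∃ c : complexBetti B.X (2 * p), IsRationalClass c ∧ IsOfHodgeType (p * q) B.X (2 * p) p p c ∧
          c ∉ divisorClassesSpan B.X (p * q) p := by
  haveI := isCMField_of_cyclicFrame L hF
  obtain ⟨B, ι', θ', hB⟩ := exists_isCMTypeRealisation (cmTypeOfResidues (L := L) S hS)
  exact ⟨B, ι', θ', hB, isSimple_of_forall_not_isStableUnder hprim hB, dim_eq hF hB,
    exists_exceptional_of_hasConstantRows hF hprim hr hB⟩

end AbelianVarieties

/-! ## §5 The exact rank of the `p`-dominated types, and REMARK 4.9: primitive degenerate types exist for every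
prime `ℓ ≡ 1 (mod 2pq)` with `(ℓ − 1)/2 = pq` -/

section Rank

variable {ℓ : ℕ} [NeZero ℓ] {p q : ℕ} {τ κ : (ZMod ℓ)ˣ}
variable (L : Type) [Field L] [NumberField L] [IsCyclotomicExtension {ℓ} ℚ L]
variable {S : Finset (ZMod ℓ)}

/-- **The rank of a primitive `p`-dominated type: `rank(Φ_S) = (p − 1)q + 2`** (the defect is `q − 1`: exactly the
`q − 1` odd characters of order `2q` vanish on `S`; §5 "a `ℤ`-basis of `V_{2q} ∩ ℤ[ℤ/2nℤ]` is given by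
`w_k^{(2q)}`, `1 ≤ k ≤ q − 1`", i.e. `dim Hg(A_S) = pq − q + 1`). [cite: Hazama2003CyclicCM, §5 (p. 597), Prop. 2.1 and Thm. 4.8 (iv)]
[cite: Kubota1965, §4 Lemma 2] -/
theorem cmTypeRank_eq_of_hasConstantRows (hF : CyclicFrame p q (-1 : (ZMod ℓ)ˣ) τ κ)
    (hS : ∀ c : ZMod ℓ, c.val.Coprime ℓ → (c ∈ S ↔ -c ∉ S))
    (hprim : ∀ u : (ZMod ℓ)ˣ, u ≠ 1 → ¬ IsStableUnder 𝓤[ℓ, S] u)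
    (hr : haveI : NeZero p := ⟨hF.prime_left.ne_zero⟩; HasConstantRows p q 𝓤[ℓ, S] τ κ) :
    cmTypeRank (cmTypeOfResidues (L := L) S hS) = (p - 1) * q + 2 := by
  rw [CyclotomicFermatCMType.cmTypeRank_cmTypeOfResidues_eq ℓ L hS]
  exact typeRank_eq_of_primitive_of_hasConstantRows hF (CyclotomicFermatCMType.isCMTypeWith_unitsFilter ℓ hS)
    hprim hr

/-- **The rank of a primitive `q`-dominated type: `rank(Φ_S) = (q − 1)p + 2`.**
[cite: Hazama2003CyclicCM, §5 (p. 597), Prop. 2.1 and Thm. 4.8 (v)] [cite: Kubota1965, §4 Lemma 2] -/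
theorem cmTypeRank_eq_of_hasConstantCols (hF : CyclicFrame p q (-1 : (ZMod ℓ)ˣ) τ κ)
    (hS : ∀ c : ZMod ℓ, c.val.Coprime ℓ → (c ∈ S ↔ -c ∉ S))
    (hprim : ∀ u : (ZMod ℓ)ˣ, u ≠ 1 → ¬ IsStableUnder 𝓤[ℓ, S] u)
    (hc : haveI : NeZero q := ⟨hF.prime_right.ne_zero⟩; HasConstantRows q p 𝓤[ℓ, S] κ τ) :
    cmTypeRank (cmTypeOfResidues (L := L) S hS) = (q - 1) * p + 2 :=
  cmTypeRank_eq_of_hasConstantRows L hF.swap hS hprim hc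

open scoped Classical in
/-- **The rank with its defect** (Prop. 2.1 + Thm. 4.8 for `ℚ(ζ_ℓ)`): `rank(Φ_S) + (q−1)[S ∈ S_p] + (p−1)[S ∈ S_q]
+ (p−1)(q−1)[S ∈ S₁] = pq + 1`. [cite: Hazama2003CyclicCM, Prop. 2.1 and Thm. 4.8 (ii)] [cite: Kubota1965, §4 Lemma 2] -/
theorem cmTypeRank_add_defect_eq (hF : CyclicFrame p q (-1 : (ZMod ℓ)ˣ) τ κ)
    (hS : ∀ c : ZMod ℓ, c.val.Coprime ℓ → (c ∈ S ↔ -c ∉ S)) :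
    haveI : NeZero p := ⟨hF.prime_left.ne_zero⟩
    haveI : NeZero q := ⟨hF.prime_right.ne_zero⟩
    cmTypeRank (cmTypeOfResidues (L := L) S hS) +
        ((if HasConstantRows p q 𝓤[ℓ, S] τ κ then q - 1 else 0) +
          (if HasConstantRows q p 𝓤[ℓ, S] κ τ then p - 1 else 0) +
          (if IsStableUnder 𝓤[ℓ, S] τ ∨ IsStableUnder 𝓤[ℓ, S] κ then (p - 1) * (q - 1) else 0)) = p * q + 1 := by
  rw [CyclotomicFermatCMType.cmTypeRank_cmTypeOfResidues_eq ℓ L hS]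
  exact typeRank_add_defect_eq hF (CyclotomicFermatCMType.isCMTypeWith_unitsFilter ℓ hS)

/-- The unit-group picture of the image of a set of units: `𝓤[ℓ, val(Φ)] = Φ`. [cite: Washington1997, Thm. 2.5] -/
theorem unitsFilter_image_val (Φ : Finset (ZMod ℓ)ˣ) :
    𝓤[ℓ, Φ.image fun u : (ZMod ℓ)ˣ => (u : ZMod ℓ)] = Φ := by
  ext u
  simp only [Finset.mem_filter, Finset.mem_univ, true_and, Finset.mem_image]
  constructor
  · rintro ⟨v, hv, hvu⟩
    rwa [← Units.ext hvu]
  · intro hu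
    exact ⟨u, hu, rfl⟩

/-- A group-level CM type `Φ ⊆ (ℤ/ℓ)ˣ` for `ρ = −1` gives the CM residue set `val(Φ)`.
[cite: Shimura1998, §8.4 Example (1)] -/
theorem isCMResidueSet_image_val {Φ : Finset (ZMod ℓ)ˣ} (h : IsCMTypeWith (-1 : (ZMod ℓ)ˣ) (Φ : Set (ZMod ℓ)ˣ)) :
    IsCMResidueSet ℓ (Φ.image fun u : (ZMod ℓ)ˣ => (u : ZMod ℓ)) := by
  refine ⟨image_val_subset_unitResidues Φ, fun c hc => ?_⟩
  obtain ⟨u, rfl⟩ : ∃ u : (ZMod ℓ)ˣ, (u : ZMod ℓ) = c :=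
    ⟨ZMod.unitOfCoprime c.val ((coprime_iff_mem_unitResidues ℓ c).2 hc), coe_unitOfCoprime_of_mem hc⟩
  have hmem : ∀ v : (ZMod ℓ)ˣ, (v : ZMod ℓ) ∈ Φ.image (fun u : (ZMod ℓ)ˣ => (u : ZMod ℓ)) ↔ v ∈ Φ := fun v => by
    rw [← mem_unitsFilter_iff (S := Φ.image fun u : (ZMod ℓ)ˣ => (u : ZMod ℓ)), unitsFilter_image_val]
  rw [show -(u : ZMod ℓ) = ((-1 * u : (ZMod ℓ)ˣ) : ZMod ℓ) by
    rw [Units.val_mul, Units.val_neg, Units.val_one, neg_one_mul], hmem, hmem]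
  have := h.mem_iff u
  rwa [Finset.mem_coe, smul_eq_mul, Finset.mem_coe] at this

/-- **REMARK 4.9 (effective Lenstra–Stark) for every pair `p ≠ q`, on residues**: every frame of `(ℤ/ℓ)ˣ` carries a
PRIMITIVE `p`-DOMINATED CM residue set `S` (Hazama's §6 matrix `a_{i1} = 1`: one point in each row).
[cite: Hazama2003CyclicCM, Rem. 4.9, Prop. 4.3 and §6] -/
theorem exists_primitive_hasConstantRows_residues (hF : CyclicFrame p q (-1 : (ZMod ℓ)ˣ) τ κ) :
    haveI : NeZero p := ⟨hF.prime_left.ne_zero⟩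
    ∃ S : Finset (ZMod ℓ), IsCMResidueSet ℓ S ∧ (∀ u : (ZMod ℓ)ˣ, u ≠ 1 → ¬ IsStableUnder 𝓤[ℓ, S] u) ∧
      HasConstantRows p q 𝓤[ℓ, S] τ κ := by
  haveI : NeZero p := ⟨hF.prime_left.ne_zero⟩
  obtain ⟨Φ, h, hr, hprim⟩ := exists_primitive_hasConstantRows hF
  refine ⟨Φ.image fun u : (ZMod ℓ)ˣ => (u : ZMod ℓ), isCMResidueSet_image_val h, ?_, ?_⟩
  · rw [unitsFilter_image_val]; exact hprim
  · rw [unitsFilter_image_val]; exact hr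

/-- **REMARK 4.9 + THEOREM 4.8 (iv) + REMARK 4.10 for `ℚ(ζ_ℓ)`**: for every prime `ℓ` with `ℓ − 1 = 2pq` (`p ≠ q`
odd primes) the cyclotomic field `ℚ(ζ_ℓ)` has a PRIMITIVE, DEGENERATE CM type `Φ_S` — `p`-dominated, of rank
`(p − 1)q + 2 < pq + 1` — every abelian variety of which is SIMPLE of dimension `pq` and carries a rational
`(p,p)`-class outside `Dᵖ ⊗ ℂ` ("there is always a degenerate CM-type for `ℚ(ζ_{2n+1})` whenever `n` is the product
of three and an odd prime `> 3`" is the case `p = 3`). [cite: Hazama2003CyclicCM, Rem. 4.9–4.10 and Thm. 4.8 (iv)]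
[cite: Gordon1999HodgeAVSurvey, 9.2.2] -/
theorem exists_primitive_degenerate {ℓ p q : ℕ} [Fact ℓ.Prime] (hp : p.Prime) (hq : q.Prime) (hpq : p ≠ q)
    (hp2 : p ≠ 2) (hq2 : q ≠ 2) (hℓ : ℓ = 2 * (p * q) + 1)
    (L : Type) [Field L] [NumberField L] [IsCyclotomicExtension {ℓ} ℚ L] :
    ∃ (S : Finset (ZMod ℓ)) (hS : ∀ c : ZMod ℓ, c.val.Coprime ℓ → (c ∈ S ↔ -c ∉ S)),
      (∀ φ₀ : L →+* ℂ, IsPrimitive (ℂ ≃+* ℂ) (cmTypeOfResidues (L := L) S hS).1 φ₀) ∧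
      ¬ IsNondegenerate (cmTypeOfResidues (L := L) S hS) ∧
      cmTypeRank (cmTypeOfResidues (L := L) S hS) = (p - 1) * q + 2 ∧
      ∀ (A : AbelianVariety ℂ) (ι : 𝓞 L →+* End A) (θ : L →+* Module.End ℂ (complexBetti A.X 1)),
        IsCMTypeRealisation (cmTypeOfResidues (L := L) S hS) A ι θ →
          A.IsSimple ∧ A.dim = p * q ∧
            ∃ c : complexBetti A.X (2 * p), IsRationalClass c ∧ IsOfHodgeType (p * q) A.X (2 * p) p p c ∧
              c ∉ divisorClassesSpan A.X (p * q) p := by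
  haveI : NeZero ℓ := ⟨(Fact.out : ℓ.Prime).ne_zero⟩
  obtain ⟨τ, κ, hF⟩ := exists_cyclicFrame_units hp hq hpq hp2 hq2 hℓ
  haveI : NeZero p := ⟨hF.prime_left.ne_zero⟩
  obtain ⟨S, hSc, hprim, hr⟩ := exists_primitive_hasConstantRows_residues hF
  refine ⟨S, hSc.cm, fun φ₀ => (isPrimitive_iff L hSc hSc.cm φ₀).2 hprim,
    not_isNondegenerate_of_hasConstantRows L hF hSc.cm hr, cmTypeRank_eq_of_hasConstantRows L hF hSc.cm hprim hr,
    fun A ι θ hA => ⟨isSimple_of_forall_not_isStableUnder hprim hA, dim_eq hF hA,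
      exists_exceptional_of_hasConstantRows hF hprim hr hA⟩⟩

/-- **Simple degenerate abelian varieties with CM by `ℚ(ζ_ℓ)` and `Bᵖ ≠ Dᵖ` EXIST for every prime `ℓ = 2pq + 1`**
(Shimura §6.2 Thm. 3 = tree `exists_isCMTypeRealisation` on the type of `exists_primitive_degenerate`): a simple
abelian variety of dimension `pq`, of a primitive degenerate CM type of `ℚ(ζ_ℓ)` of rank `(p − 1)q + 2`, with a
rational `(p,p)`-class outside `Dᵖ ⊗ ℂ`. [cite: Hazama2003CyclicCM, Rem. 4.9–4.10 and Thm. 4.8 (iv)]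
[cite: Shimura1998, §6.2 Theorem 3] -/
theorem exists_simple_degenerate_exceptional {ℓ p q : ℕ} [Fact ℓ.Prime] (hp : p.Prime) (hq : q.Prime)
    (hpq : p ≠ q) (hp2 : p ≠ 2) (hq2 : q ≠ 2) (hℓ : ℓ = 2 * (p * q) + 1)
    (L : Type) [Field L] [NumberField L] [IsCyclotomicExtension {ℓ} ℚ L] :
    ∃ (S : Finset (ZMod ℓ)) (hS : ∀ c : ZMod ℓ, c.val.Coprime ℓ → (c ∈ S ↔ -c ∉ S))
      (A : AbelianVariety ℂ) (ι : 𝓞 L →+* End A) (θ : L →+* Module.End ℂ (complexBetti A.X 1)),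
      IsCMTypeRealisation (cmTypeOfResidues (L := L) S hS) A ι θ ∧
      (∀ φ₀ : L →+* ℂ, IsPrimitive (ℂ ≃+* ℂ) (cmTypeOfResidues (L := L) S hS).1 φ₀) ∧
      cmTypeRank (cmTypeOfResidues (L := L) S hS) = (p - 1) * q + 2 ∧
      ¬ IsNondegenerate (cmTypeOfResidues (L := L) S hS) ∧
      A.IsSimple ∧ A.dim = p * q ∧
        ∃ c : complexBetti A.X (2 * p), IsRationalClass c ∧ IsOfHodgeType (p * q) A.X (2 * p) p p c ∧
          c ∉ divisorClassesSpan A.X (p * q) p := by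
  haveI : NeZero ℓ := ⟨(Fact.out : ℓ.Prime).ne_zero⟩
  obtain ⟨τ, κ, hF⟩ := exists_cyclicFrame_units hp hq hpq hp2 hq2 hℓ
  haveI := isCMField_of_cyclicFrame L hF
  obtain ⟨S, hS, hprim, hdeg, hrank, hall⟩ := exists_primitive_degenerate hp hq hpq hp2 hq2 hℓ L
  obtain ⟨A, ι, θ, hA⟩ := exists_isCMTypeRealisation (cmTypeOfResidues (L := L) S hS)
  exact ⟨S, hS, A, ι, θ, hA, hprim, hrank, hdeg, hall A ι θ hA⟩

end Rank

end CyclotomicTwoOddPrimes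

end Literature.AlgebraicGeometry.ComplexMultiplication

end
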